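import Summits.HodgeConjecture.HodgeConjecture.Theorems.F0P2oN3OfLineJacquet   -- (this seat) the η-free (a)-assembler: N3 ⟸ (N′)
import HarnessLib

/-!
# Crux `H413`, programme P2, N3 road (a) — THE η-FREE (a)-ASSEMBLER AT A CHART: N3 ⟸ (N″) «one Jacquet chart `π` of `Ω = ω_v ∘ ch` along `N`
# with `π ∘ Ω(d(1, β, 1)) = ω¹(β) ∘ π`» (print's (3.2.1) «`ω_ψ(diag(1,u,1))Φ(w) = ω_ψ^{s′}(u)(Φ(w))`» read at `w = 0`)

Cell hodgecm-mathlib (D-0151), FLOOR 0, crux item H413 = stmt-HodgeConjecture-24833, programme P2; K1 sub-line `Cruxes/H413/Lines/F0_P2GR91NJacquetK1.lean`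
(residue = the print letter N3 #96 ★ `GelbartRogawski1991.thetaType_nonsplit_jacquetModule`, after ★ p836093 its clause (a) alone); N3 road of the K1 lead B-p18 (g29).
Seat F0P2-p06 (g4).  THEOREMS ONLY (no `def`, no instance, no notation, no named fact, no `sorry`); no `Cruxes/…/Lines` import; kernel lane
`--supports stmt-HodgeConjecture-24833 --as helper`.  HONEST LABEL: HC_CM is proved only modulo the 2 remaining named inputs (hLiu418, h413) — behind them the
booked printed statements + the MOD package — until rung 0 closes; this file proves no letter.

WHAT.  The sibling file `F0P2oN3OfLineJacquet` reduces N3 to (N′): a linear isomorphism `Tr : r_N(Ω) ≃ 𝒮(Fin n₀ → L⁺_v)` carrying the Jacquet action of the line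
elements `d(1, β, 1)` to GR's `ω¹ = ★ lineWeilCM L e₀ (kernelLineCM dV) … μ hμ ε v`.  The (N)-block of the road works at a CHART (F0P2-p01 (g8)'s ★ (E1-CM)
`F0P2oYCoinvariantsChartCM.exists_chart_of_nonsplit`: `π = φ₀ ∘ Ψ`, `ker π = Coinvariants.ker (Ω|_N)`), so this file states the same socket AT A CHART:
§1 `exists_coinvariantsEquiv_of_chart` — generic: a surjective `π : V →ₗ S` with `ker π = Coinvariants.ker (ρ|_N)` induces `r_N(ρ) ≃ₗ S`, `[v] ↦ π v` (Mathlib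
`Submodule.quotEquivOfEq` ∘ `LinearMap.quotKerEquivOfSurjective`, ★ p835430 `coinvariantsKer_restrict_eq`);
§2 **`nonempty_jacquet_xThetaGqsCM_equiv_weightSpace_of_chartLine`** — clause (a) of N3 (token for token) from a chart `(π, hπ, hker)` (★ p834861's binders, `ch`
spelling of ★ p835944), a model isomorphism `TrS : S ≃ₗ 𝒮(Fin n₀ → L⁺_v)` and the ONE identity **(N″) `TrS (π (Ω (d(1, β, 1)) f)) = ω¹(β) (TrS (π f))`**;
§3 **`thetaType_nonsplit_jacquetModule_of_chartLine`** — N3 VERBATIM from (N″) ∀-closed over the letter's `χ_f`-free binders, chart valued in `𝒮(Fin n₀ → L⁺_v)`;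
§4 **`stubN3a_of_lineJacquet`** ∕ **`stubN3a_of_chartLine`** — the desk's fold sockets: the TYPE of the Lines files' `stub_N3a_letter` (clause (a) ∀-closed = `hA` of ★ p836093)
from (N′) resp. (N″) ∀-closed (one-token folds `stub_N3a_letter := stubN3a_of_lineJacquet ‹FQN›`).
[GelbartRogawski1991 §3.2 (3.2.1)–(3.2.3) p. 457; Kudla1986 Thm. 2.8; BernsteinZelevinsky1977 §1.8.]

## References
* [GelbartRogawski1991] S. Gelbart, J. Rogawski, Invent. Math. 105 (1991): §3.2 (3.2.1)–(3.2.3) p. 457; §5.2 p. 467.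
* [Kudla1986] S. Kudla, Invent. Math. 83 (1986): Thm. 2.8.  [BernsteinZelevinsky1977] Ann. sci. ÉNS 10 (1977): §1.8.  [Rogawski1990] Ann. of Math. Stud. 123: §12.2 (2) p. 174.
-/

set_option autoImplicit false
-- the mandated namespace has the single-problem summit's repeated segment (`HodgeConjecture.HodgeConjecture`)
set_option linter.dupNamespace false

noncomputable section

open NumberField IsDedekindDomain MeasureTheory
open scoped Matrix Kronecker

open Literature.NumberTheory Literature.NumberTheory.Automorphic Literature.NumberTheory.Automorphic.UnitaryGroup
open Literature.NumberTheory.Automorphic.IdeleClassGroup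
open Literature.NumberTheory.Automorphic.Liu2021 Literature.NumberTheory.Automorphic.Liu2021.Def411WeilCarriers
open Literature.NumberTheory.Automorphic.Liu2021.Def411WeilCarriersDoubling
open Literature.NumberTheory.GelbartRogawski1991.UnitaryDualPair Literature.NumberTheory.GelbartRogawski1991.UnitaryDualPair.WeilCoinv
open Literature.RepresentationTheory.Liu2021
open Literature.NumberTheory.GaloisRepresentations
open Literature.NumberTheory.Rogawski1990
open Literature.NumberTheory.GelbartRogawski1991
open Literature.RepresentationTheory

open Summit.HodgeConjecture.HodgeConjecture.Cruxes.H413.F0P2oN3TorusWeightOfD3d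
open Summit.HodgeConjecture.HodgeConjecture.Cruxes.H413.F0P2oN3OfLineJacquet

namespace Summit.HodgeConjecture.HodgeConjecture.Cruxes.H413.F0P2oN3OfLineJacquetChart

/-! ## §1 Generic: a Jacquet chart is the Jacquet module -/

/-- **A Jacquet chart IS the Jacquet module**: a surjective linear map `π : V → S` whose kernel is the `N`-relation submodule of `ρ` induces a linear
isomorphism `r_N(ρ) ≃ S` with `[v] ↦ π v` (first isomorphism theorem; ★ `coinvariantsKer_restrict_eq` for the two spellings of `ρ|_N`).
[cite: BernsteinZelevinsky1977, §1.8] -/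
theorem exists_coinvariantsEquiv_of_chart {k G V S : Type*} [CommRing k] [Group G] [AddCommGroup V] [Module k V] [AddCommGroup S] [Module k S]
    (ρ : Representation k G V) (t : ParabolicTriple G) (π : V →ₗ[k] S) (hπ : Function.Surjective π)
    (hker : LinearMap.ker π = Representation.Coinvariants.ker (ρ.comp t.N.subtype)) :
    ∃ e : (t.restrict ρ).Coinvariants ≃ₗ[k] S, ∀ v : V, e (Representation.Coinvariants.mk (t.restrict ρ) v) = π v := by
  have hk : Representation.Coinvariants.ker (t.restrict ρ) = LinearMap.ker π := (coinvariantsKer_restrict_eq ρ t).trans hker.symm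
  exact ⟨(Submodule.quotEquivOfEq _ _ hk).trans (π.quotKerEquivOfSurjective hπ), fun v => LinearMap.quotKerEquivOfSurjective_apply_mk π hπ v⟩

/-! ## §2 Clause (a) of N3 from a chart-level line identity (N″) -/

section ClauseA

variable (L : Type) [Field L] [NumberField L] [IsCMField L]

set_option synthInstance.maxHeartbeats 400000 in
set_option maxHeartbeats 32000000 in
/-- **CLAUSE (a) OF ★ `thetaType_nonsplit_jacquetModule` («`r_N(X_v) ≃ ℱ_v[ψθ]`», token for token) FROM A JACQUET CHART CARRYING THE LINE ACTION (N″).**  Under the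
letter's binders: IF `π : 𝒮(Fin n′ → L⁺_v) →ₗ S` is onto with `ker π` the `N`-relation submodule of `Ω = ω_v ∘ ch` (★ p834861's `hπ`∕`hker`, `ch` spelling of ★ p835944),
`TrS : S ≃ₗ 𝒮(Fin n₀ → L⁺_v)`, and for every line element `t = d(1, det u, 1)` (`u ∈ U((ε))(L⁺_v)`) and every `f`, **`TrS (π (Ω t f)) = ω¹(u) (TrS (π f))`**
(`ω¹ = ★ lineWeilCM L e₀ (kernelLineCM dV) … μ hμ ε v`) — print's (3.2.1) at `w = 0` — THEN `Nonempty (r_N(X_v) ≃ₗ[ℂ] ℱ_v[ψθ])`: §1 then ★ (sibling)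
`nonempty_jacquet_xThetaGqsCM_equiv_weightSpace_of_lineJacquet` with `Tr := (r_N(Ω) ≃ S) ≫ TrS`.
[cite: GelbartRogawski1991, §3.2 (3.2.1)–(3.2.3) p. 457; §5.2 p. 467 L25–27] [cite: Kudla1986, Thm. 2.8] [cite: BernsteinZelevinsky1977, §1.8] -/
theorem nonempty_jacquet_xThetaGqsCM_equiv_weightSpace_of_chartLine {n' : ℕ} (e₁ : Fin 3 × Fin 1 ≃ Fin n') (dV : Fin 3 → L)
    (hdV : ∀ i, IsCMField.complexConj L (dV i) = dV i) (hdV0 : ∀ i, dV i ≠ 0) {n₀ : ℕ} (e₀ : Fin 1 × Fin 1 ≃ Fin n₀)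
    (μ : Literature.NumberTheory.Automorphic.IdeleClassGroup L →ₜ* Circle) (hμ : IsConjugateSymplectic L μ)
    (χf : UnitaryGroup.finAdelicOne (↥(maximalRealSubfield L)) L (IsCMField.complexConj L) →* ℂˣ) (ε : (↥(maximalRealSubfield L))ˣ)
    (v : HeightOneSpectrum (𝓞 ↥(maximalRealSubfield L))) (hv : ∀ w : PlacesOver L v, IsCMField.complexConj L • w.1 = w.1)
    (hχf : Continuous χf) (ψθ : ↥(normOneUnits (conjLocal L (IsCMField.complexConj L) v)) →* ℂˣ) (hψθ : IsThetaCenterChar L μ χf ε v ψθ)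
    (T : GL (Fin 3) (UnitaryGroup.LocalRing L v)) {a : UnitaryGroup.LocalRing L v} (ha : IsUnit a)
    (h : formCongr (conjLocal L (IsCMField.complexConj L) v) T ((Matrix.diagonal dV).map (algebraMap L (UnitaryGroup.LocalRing L v))) =
      a • (Matrix.of fun i j : Fin 3 => if i.val + j.val + 1 = 3 then (1 : L) else 0).map (algebraMap L (UnitaryGroup.LocalRing L v)))
    {S : Type*} [AddCommGroup S] [Module ℂ S]
    (π : SchwartzBruhat (Fin n' → v.adicCompletion ↥(maximalRealSubfield L)) →ₗ[ℂ] S) (hπ : Function.Surjective π)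
    (hker : LinearMap.ker π = Representation.Coinvariants.ker
      ((((chiLocalSplittingsCM L e₁ dV hdV hdV0 (toHeckeCharacter L μ) ((isOscillatorChar_toHeckeCharacter_iff μ).mpr hμ) ε).omegaLoc v).comp
        ((localLineInl L (IsCMField.complexConj L) 3 e₁ (Matrix.diagonal dV) (JW (↥(maximalRealSubfield L)) L ε) v).comp
          ((localPiEquiv L (IsCMField.complexConj L) 3 (Matrix.diagonal dV) v).symm.toMonoidHom.comp
            (cmDatumLocalCongr L v T ha h).toMonoidHom))).comp (cmBorelTriple L 3 v).N.subtype))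
    (TrS : S ≃ₗ[ℂ] SchwartzBruhat (Fin n₀ → v.adicCompletion ↥(maximalRealSubfield L)))
    (hline : ∀ (u : localPi L (IsCMField.complexConj L) 1 (JW (↥(maximalRealSubfield L)) L ε) v) (t : ↥(cmBorelTriple L 3 v).M),
      glDiagonal 3 (LocalRing L v) ![1, ((localDet (IsCMField.complexConj L) v
        (isUnit_iff_ne_zero.mpr (by rw [Matrix.det_fin_one]; exact JW_apply_ne_zero (↥(maximalRealSubfield L)) L ε))
        (localPiEquiv L (IsCMField.complexConj L) 1 (JW (↥(maximalRealSubfield L)) L ε) v u) :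
          ↥(normOneUnits (conjLocal L (IsCMField.complexConj L) v))) : (LocalRing L v)ˣ), 1] =
        ((t : ↥(unitaryGroupOfForm (conjLocal L (IsCMField.complexConj L) v) (cmLocalForm L 3 v))) : GL (Fin 3) (LocalRing L v)) →
      ∀ f : SchwartzBruhat (Fin n' → v.adicCompletion ↥(maximalRealSubfield L)),
        TrS (π ((chiLocalSplittingsCM L e₁ dV hdV hdV0 (toHeckeCharacter L μ) ((isOscillatorChar_toHeckeCharacter_iff μ).mpr hμ) ε).omegaLoc v
          (((localLineInl L (IsCMField.complexConj L) 3 e₁ (Matrix.diagonal dV) (JW (↥(maximalRealSubfield L)) L ε) v).comp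
            ((localPiEquiv L (IsCMField.complexConj L) 3 (Matrix.diagonal dV) v).symm.toMonoidHom.comp
              (cmDatumLocalCongr L v T ha h).toMonoidHom)) (t : ↥(unitaryGroupOfForm (conjLocal L (IsCMField.complexConj L) v) (cmLocalForm L 3 v)))) f)) =
        lineWeilCM L e₀ (kernelLineCM dV) (complexConj_kernelLineCM dV hdV) (kernelLineCM_ne_zero dV hdV0) μ hμ ε v u (TrS (π f))) :
    Nonempty (((cmBorelTriple L 3 v).restrict (xThetaGqsCM L e₁ dV hdV hdV0 μ hμ χf ε v T ha h)).Coinvariants ≃ₗ[ℂ]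
      ↥(weightSpace (lineWeilCM L e₀ (kernelLineCM dV) (complexConj_kernelLineCM dV hdV) (kernelLineCM_ne_zero dV hdV0) μ hμ ε v) id
        (fun u => ((ψθ (localDet (IsCMField.complexConj L) v
          (isUnit_iff_ne_zero.mpr (by rw [Matrix.det_fin_one]; exact JW_apply_ne_zero (↥(maximalRealSubfield L)) L ε))
          (localPiEquiv L (IsCMField.complexConj L) 1 (JW (↥(maximalRealSubfield L)) L ε) v u)) : ℂˣ) : ℂ)))) := by
  obtain ⟨e, he⟩ := exists_coinvariantsEquiv_of_chart
    (((chiLocalSplittingsCM L e₁ dV hdV hdV0 (toHeckeCharacter L μ) ((isOscillatorChar_toHeckeCharacter_iff μ).mpr hμ) ε).omegaLoc v).comp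
      ((localLineInl L (IsCMField.complexConj L) 3 e₁ (Matrix.diagonal dV) (JW (↥(maximalRealSubfield L)) L ε) v).comp
        ((localPiEquiv L (IsCMField.complexConj L) 3 (Matrix.diagonal dV) v).symm.toMonoidHom.comp
          (cmDatumLocalCongr L v T ha h).toMonoidHom)))
    (cmBorelTriple L 3 v) π hπ hker
  refine nonempty_jacquet_xThetaGqsCM_equiv_weightSpace_of_lineJacquet L e₁ dV hdV hdV0 e₀ μ hμ χf ε v hv hχf ψθ hψθ T ha h (e.trans TrS)
    fun u t ht x => ?_
  obtain ⟨f, rfl⟩ := Representation.Coinvariants.mk_surjective _ x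
  -- `Tr [Ω t f] = TrS (π (Ω t f)) = ω¹(u) (TrS (π f)) = ω¹(u) (Tr [f])` (★ `jacquetModule_mk` is `rfl`)
  exact (congrArg TrS (he _)).trans ((hline u t ht f).trans (congrArg _ (congrArg TrS (he f)).symm))

end ClauseA

/-! ## §3 N3 from a `𝒮(Fin n₀ → L⁺_v)`-valued Jacquet chart carrying the line action -/

set_option synthInstance.maxHeartbeats 400000 in
set_option maxHeartbeats 32000000 in
/-- **N3 FROM (N″), ∀-closed over the letter's `χ_f`-free binders**: if for every datum `(L, e₁, dV, e₀, μ, v` non-split, `ε, T, a, h)` there is an onto linear map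
`π : 𝒮(Fin n′ → L⁺_v) → 𝒮(Fin n₀ → L⁺_v)` with `ker π = Coinvariants.ker (Ω|_N)` and `π (Ω (d(1, det u, 1)) f) = ω¹(u) (π f)` — the Jacquet module of the Weil
representation along the Borel IS GR's rank-one oscillator representation `ℱ` for the `U₁ = {diag(1, u, 1)}`-action [GelbartRogawski1991 §3.2 (3.2.1)+(3.2.3)
p. 457; Kudla1986 Thm. 2.8] — then the print letter ★ `GelbartRogawski1991.thetaType_nonsplit_jacquetModule` holds VERBATIM (§2 at `TrS := refl`, then ★ p836093).
[cite: GelbartRogawski1991, §3.2 (3.2.1)–(3.2.3) p. 457; §5.2 p. 467] [cite: Kudla1986, Thm. 2.8] [cite: Rogawski1990, §12.2 (2) p. 174] -/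
theorem thetaType_nonsplit_jacquetModule_of_chartLine
    (hL : ∀ (L : Type) [Field L] [NumberField L] [IsCMField L]
      {n' : ℕ} (e₁ : Fin 3 × Fin 1 ≃ Fin n') (dV : Fin 3 → L) (hdV : ∀ i, IsCMField.complexConj L (dV i) = dV i) (hdV0 : ∀ i, dV i ≠ 0)
      {n₀ : ℕ} (e₀ : Fin 1 × Fin 1 ≃ Fin n₀)
      (μ : Literature.NumberTheory.Automorphic.IdeleClassGroup L →ₜ* Circle) (hμ : IsConjugateSymplectic L μ)
      (v : HeightOneSpectrum (𝓞 ↥(maximalRealSubfield L))),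
        (∀ w : PlacesOver L v, IsCMField.complexConj L • w.1 = w.1) →
        ∀ (ε : (↥(maximalRealSubfield L))ˣ)
          (T : GL (Fin 3) (UnitaryGroup.LocalRing L v)) (a : UnitaryGroup.LocalRing L v) (ha : IsUnit a)
          (h : formCongr (conjLocal L (IsCMField.complexConj L) v) T ((Matrix.diagonal dV).map (algebraMap L (UnitaryGroup.LocalRing L v))) =
            a • (Matrix.of fun i j : Fin 3 => if i.val + j.val + 1 = 3 then (1 : L) else 0).map (algebraMap L (UnitaryGroup.LocalRing L v))),
          ∃ π : SchwartzBruhat (Fin n' → v.adicCompletion ↥(maximalRealSubfield L)) →ₗ[ℂ] SchwartzBruhat (Fin n₀ → v.adicCompletion ↥(maximalRealSubfield L)),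
            Function.Surjective π ∧
            LinearMap.ker π = Representation.Coinvariants.ker
              ((((chiLocalSplittingsCM L e₁ dV hdV hdV0 (toHeckeCharacter L μ) ((isOscillatorChar_toHeckeCharacter_iff μ).mpr hμ) ε).omegaLoc v).comp
                ((localLineInl L (IsCMField.complexConj L) 3 e₁ (Matrix.diagonal dV) (JW (↥(maximalRealSubfield L)) L ε) v).comp
                  ((localPiEquiv L (IsCMField.complexConj L) 3 (Matrix.diagonal dV) v).symm.toMonoidHom.comp
                    (cmDatumLocalCongr L v T ha h).toMonoidHom))).comp (cmBorelTriple L 3 v).N.subtype) ∧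
            ∀ (u : localPi L (IsCMField.complexConj L) 1 (JW (↥(maximalRealSubfield L)) L ε) v) (t : ↥(cmBorelTriple L 3 v).M),
              glDiagonal 3 (LocalRing L v) ![1, ((localDet (IsCMField.complexConj L) v
                (isUnit_iff_ne_zero.mpr (by rw [Matrix.det_fin_one]; exact JW_apply_ne_zero (↥(maximalRealSubfield L)) L ε))
                (localPiEquiv L (IsCMField.complexConj L) 1 (JW (↥(maximalRealSubfield L)) L ε) v u) :
                  ↥(normOneUnits (conjLocal L (IsCMField.complexConj L) v))) : (LocalRing L v)ˣ), 1] =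
                ((t : ↥(unitaryGroupOfForm (conjLocal L (IsCMField.complexConj L) v) (cmLocalForm L 3 v))) : GL (Fin 3) (LocalRing L v)) →
              ∀ f : SchwartzBruhat (Fin n' → v.adicCompletion ↥(maximalRealSubfield L)),
                π ((chiLocalSplittingsCM L e₁ dV hdV hdV0 (toHeckeCharacter L μ) ((isOscillatorChar_toHeckeCharacter_iff μ).mpr hμ) ε).omegaLoc v
                  (((localLineInl L (IsCMField.complexConj L) 3 e₁ (Matrix.diagonal dV) (JW (↥(maximalRealSubfield L)) L ε) v).comp
                    ((localPiEquiv L (IsCMField.complexConj L) 3 (Matrix.diagonal dV) v).symm.toMonoidHom.comp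
                      (cmDatumLocalCongr L v T ha h).toMonoidHom)) (t : ↥(unitaryGroupOfForm (conjLocal L (IsCMField.complexConj L) v) (cmLocalForm L 3 v)))) f) =
                lineWeilCM L e₀ (kernelLineCM dV) (complexConj_kernelLineCM dV hdV) (kernelLineCM_ne_zero dV hdV0) μ hμ ε v u (π f)) :
    Literature.NumberTheory.GelbartRogawski1991.thetaType_nonsplit_jacquetModule := by
  refine F0P2oN3TorusWeightHolds.thetaType_nonsplit_jacquetModule_of_a fun L _ _ _ n' e₁ dV hdV hdV0 n₀ e₀ μ hμ χf hc _ v hv ε ψθ hθ T a ha h => ?_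
  obtain ⟨π, hπ, hker, hline⟩ := hL L e₁ dV hdV hdV0 e₀ μ hμ v hv ε T a ha h
  exact nonempty_jacquet_xThetaGqsCM_equiv_weightSpace_of_chartLine L e₁ dV hdV hdV0 e₀ μ hμ χf ε v hv hc ψθ hθ T ha h π hπ hker
    (LinearEquiv.refl ℂ _) hline

/-! ## §4 The desk's fold sockets: clause (a) ∀-CLOSED (the type of `stub_N3a_letter`) from (N′) ∕ (N″) ∀-closed -/

set_option synthInstance.maxHeartbeats 400000 in
set_option maxHeartbeats 32000000 in
/-- **`stub_N3a_letter` FROM (N′)** — clause (a) of N3 ∀-closed over the letter's binders (the `hA` socket of ★ p835661 ∕ ★ p836093, i.e. the TYPE of the Lines files'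
`stub_N3a_letter`, token for token) from the line-Jacquet intertwiner (N′) ∀-closed over the `χ_f`-free binders (the `hL` of ★ p837961
`thetaType_nonsplit_jacquetModule_of_lineJacquet`, token for token). One-token fold: `stub_N3a_letter := stubN3a_of_lineJacquet ‹(N′) FQN›`.
[cite: GelbartRogawski1991, §3.2 (3.2.1)–(3.2.3) p. 457] [cite: Kudla1986, Thm. 2.8] -/
theorem stubN3a_of_lineJacquet
    (hL : ∀ (L : Type) [Field L] [NumberField L] [IsCMField L]
      {n' : ℕ} (e₁ : Fin 3 × Fin 1 ≃ Fin n') (dV : Fin 3 → L) (hdV : ∀ i, IsCMField.complexConj L (dV i) = dV i) (hdV0 : ∀ i, dV i ≠ 0)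
      {n₀ : ℕ} (e₀ : Fin 1 × Fin 1 ≃ Fin n₀)
      (μ : Literature.NumberTheory.Automorphic.IdeleClassGroup L →ₜ* Circle) (hμ : IsConjugateSymplectic L μ)
      (v : HeightOneSpectrum (𝓞 ↥(maximalRealSubfield L))),
        (∀ w : PlacesOver L v, IsCMField.complexConj L • w.1 = w.1) →
        ∀ (ε : (↥(maximalRealSubfield L))ˣ)
          (T : GL (Fin 3) (UnitaryGroup.LocalRing L v)) (a : UnitaryGroup.LocalRing L v) (ha : IsUnit a)
          (h : formCongr (conjLocal L (IsCMField.complexConj L) v) T ((Matrix.diagonal dV).map (algebraMap L (UnitaryGroup.LocalRing L v))) =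
            a • (Matrix.of fun i j : Fin 3 => if i.val + j.val + 1 = 3 then (1 : L) else 0).map (algebraMap L (UnitaryGroup.LocalRing L v))),
          ∃ Tr : ((cmBorelTriple L 3 v).restrict
            (((chiLocalSplittingsCM L e₁ dV hdV hdV0 (toHeckeCharacter L μ) ((isOscillatorChar_toHeckeCharacter_iff μ).mpr hμ) ε).omegaLoc v).comp
              ((localLineInl L (IsCMField.complexConj L) 3 e₁ (Matrix.diagonal dV) (JW (↥(maximalRealSubfield L)) L ε) v).comp
                ((localPiEquiv L (IsCMField.complexConj L) 3 (Matrix.diagonal dV) v).symm.toMonoidHom.comp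
                  (cmDatumLocalCongr L v T ha h).toMonoidHom)))).Coinvariants ≃ₗ[ℂ]
            SchwartzBruhat (Fin n₀ → v.adicCompletion ↥(maximalRealSubfield L)),
          ∀ (u : localPi L (IsCMField.complexConj L) 1 (JW (↥(maximalRealSubfield L)) L ε) v) (t : ↥(cmBorelTriple L 3 v).M),
            glDiagonal 3 (LocalRing L v) ![1, ((localDet (IsCMField.complexConj L) v
              (isUnit_iff_ne_zero.mpr (by rw [Matrix.det_fin_one]; exact JW_apply_ne_zero (↥(maximalRealSubfield L)) L ε))
              (localPiEquiv L (IsCMField.complexConj L) 1 (JW (↥(maximalRealSubfield L)) L ε) v u) :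
                ↥(normOneUnits (conjLocal L (IsCMField.complexConj L) v))) : (LocalRing L v)ˣ), 1] =
              ((t : ↥(unitaryGroupOfForm (conjLocal L (IsCMField.complexConj L) v) (cmLocalForm L 3 v))) : GL (Fin 3) (LocalRing L v)) →
            ∀ x, Tr (Representation.jacquetModule
              (((chiLocalSplittingsCM L e₁ dV hdV hdV0 (toHeckeCharacter L μ) ((isOscillatorChar_toHeckeCharacter_iff μ).mpr hμ) ε).omegaLoc v).comp
                ((localLineInl L (IsCMField.complexConj L) 3 e₁ (Matrix.diagonal dV) (JW (↥(maximalRealSubfield L)) L ε) v).comp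
                  ((localPiEquiv L (IsCMField.complexConj L) 3 (Matrix.diagonal dV) v).symm.toMonoidHom.comp
                    (cmDatumLocalCongr L v T ha h).toMonoidHom)))
              (cmBorelTriple L 3 v) t x) =
              lineWeilCM L e₀ (kernelLineCM dV) (complexConj_kernelLineCM dV hdV) (kernelLineCM_ne_zero dV hdV0) μ hμ ε v u (Tr x)) :
    ∀ (L : Type) [Field L] [NumberField L] [IsCMField L]
      {n' : ℕ} (e₁ : Fin 3 × Fin 1 ≃ Fin n') (dV : Fin 3 → L) (hdV : ∀ i, IsCMField.complexConj L (dV i) = dV i) (hdV0 : ∀ i, dV i ≠ 0)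
      {n₀ : ℕ} (e₀ : Fin 1 × Fin 1 ≃ Fin n₀)
      (μ : Literature.NumberTheory.Automorphic.IdeleClassGroup L →ₜ* Circle) (hμ : IsConjugateSymplectic L μ)
      (χf : UnitaryGroup.finAdelicOne (↥(maximalRealSubfield L)) L (IsCMField.complexConj L) →* ℂˣ),
      Continuous χf → (∀ z, ‖((χf z : ℂˣ) : ℂ)‖ = 1) →
      ∀ (v : HeightOneSpectrum (𝓞 ↥(maximalRealSubfield L))),
        (∀ w : PlacesOver L v, IsCMField.complexConj L • w.1 = w.1) →
        ∀ (ε : (↥(maximalRealSubfield L))ˣ) (ψθ : ↥(normOneUnits (conjLocal L (IsCMField.complexConj L) v)) →* ℂˣ),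
          IsThetaCenterChar L μ χf ε v ψθ →
          ∀ (T : GL (Fin 3) (UnitaryGroup.LocalRing L v)) (a : UnitaryGroup.LocalRing L v) (ha : IsUnit a)
            (h : formCongr (conjLocal L (IsCMField.complexConj L) v) T ((Matrix.diagonal dV).map (algebraMap L (UnitaryGroup.LocalRing L v))) =
              a • (Matrix.of fun i j : Fin 3 => if i.val + j.val + 1 = 3 then (1 : L) else 0).map (algebraMap L (UnitaryGroup.LocalRing L v))),
            Nonempty (((cmBorelTriple L 3 v).restrict (xThetaGqsCM L e₁ dV hdV hdV0 μ hμ χf ε v T ha h)).Coinvariants ≃ₗ[ℂ]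
              ↥(weightSpace (lineWeilCM L e₀ (kernelLineCM dV) (complexConj_kernelLineCM dV hdV) (kernelLineCM_ne_zero dV hdV0) μ hμ ε v) id
                (fun u => ((ψθ (localDet (IsCMField.complexConj L) v
                  (isUnit_iff_ne_zero.mpr (by rw [Matrix.det_fin_one]; exact JW_apply_ne_zero (↥(maximalRealSubfield L)) L ε))
                  (localPiEquiv L (IsCMField.complexConj L) 1 (JW (↥(maximalRealSubfield L)) L ε) v u)) : ℂˣ) : ℂ)))) := by
  intro L _ _ _ n' e₁ dV hdV hdV0 n₀ e₀ μ hμ χf hc _ v hv ε ψθ hθ T a ha h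
  obtain ⟨Tr, hTr⟩ := hL L e₁ dV hdV hdV0 e₀ μ hμ v hv ε T a ha h
  exact nonempty_jacquet_xThetaGqsCM_equiv_weightSpace_of_lineJacquet L e₁ dV hdV hdV0 e₀ μ hμ χf ε v hv hc ψθ hθ T ha h Tr hTr

set_option synthInstance.maxHeartbeats 400000 in
set_option maxHeartbeats 32000000 in
/-- **`stub_N3a_letter` FROM (N″)** — the same from a `𝒮(Fin n₀ → L⁺_v)`-valued Jacquet chart carrying the line action (the `hL` of §3
`thetaType_nonsplit_jacquetModule_of_chartLine`, token for token). One-token fold: `stub_N3a_letter := stubN3a_of_chartLine ‹(N″) FQN›`.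
[cite: GelbartRogawski1991, §3.2 (3.2.1)–(3.2.3) p. 457] [cite: Kudla1986, Thm. 2.8] -/
theorem stubN3a_of_chartLine
    (hL : ∀ (L : Type) [Field L] [NumberField L] [IsCMField L]
      {n' : ℕ} (e₁ : Fin 3 × Fin 1 ≃ Fin n') (dV : Fin 3 → L) (hdV : ∀ i, IsCMField.complexConj L (dV i) = dV i) (hdV0 : ∀ i, dV i ≠ 0)
      {n₀ : ℕ} (e₀ : Fin 1 × Fin 1 ≃ Fin n₀)
      (μ : Literature.NumberTheory.Automorphic.IdeleClassGroup L →ₜ* Circle) (hμ : IsConjugateSymplectic L μ)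
      (v : HeightOneSpectrum (𝓞 ↥(maximalRealSubfield L))),
        (∀ w : PlacesOver L v, IsCMField.complexConj L • w.1 = w.1) →
        ∀ (ε : (↥(maximalRealSubfield L))ˣ)
          (T : GL (Fin 3) (UnitaryGroup.LocalRing L v)) (a : UnitaryGroup.LocalRing L v) (ha : IsUnit a)
          (h : formCongr (conjLocal L (IsCMField.complexConj L) v) T ((Matrix.diagonal dV).map (algebraMap L (UnitaryGroup.LocalRing L v))) =
            a • (Matrix.of fun i j : Fin 3 => if i.val + j.val + 1 = 3 then (1 : L) else 0).map (algebraMap L (UnitaryGroup.LocalRing L v))),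
          ∃ π : SchwartzBruhat (Fin n' → v.adicCompletion ↥(maximalRealSubfield L)) →ₗ[ℂ] SchwartzBruhat (Fin n₀ → v.adicCompletion ↥(maximalRealSubfield L)),
            Function.Surjective π ∧
            LinearMap.ker π = Representation.Coinvariants.ker
              ((((chiLocalSplittingsCM L e₁ dV hdV hdV0 (toHeckeCharacter L μ) ((isOscillatorChar_toHeckeCharacter_iff μ).mpr hμ) ε).omegaLoc v).comp
                ((localLineInl L (IsCMField.complexConj L) 3 e₁ (Matrix.diagonal dV) (JW (↥(maximalRealSubfield L)) L ε) v).comp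
                  ((localPiEquiv L (IsCMField.complexConj L) 3 (Matrix.diagonal dV) v).symm.toMonoidHom.comp
                    (cmDatumLocalCongr L v T ha h).toMonoidHom))).comp (cmBorelTriple L 3 v).N.subtype) ∧
            ∀ (u : localPi L (IsCMField.complexConj L) 1 (JW (↥(maximalRealSubfield L)) L ε) v) (t : ↥(cmBorelTriple L 3 v).M),
              glDiagonal 3 (LocalRing L v) ![1, ((localDet (IsCMField.complexConj L) v
                (isUnit_iff_ne_zero.mpr (by rw [Matrix.det_fin_one]; exact JW_apply_ne_zero (↥(maximalRealSubfield L)) L ε))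
                (localPiEquiv L (IsCMField.complexConj L) 1 (JW (↥(maximalRealSubfield L)) L ε) v u) :
                  ↥(normOneUnits (conjLocal L (IsCMField.complexConj L) v))) : (LocalRing L v)ˣ), 1] =
                ((t : ↥(unitaryGroupOfForm (conjLocal L (IsCMField.complexConj L) v) (cmLocalForm L 3 v))) : GL (Fin 3) (LocalRing L v)) →
              ∀ f : SchwartzBruhat (Fin n' → v.adicCompletion ↥(maximalRealSubfield L)),
                π ((chiLocalSplittingsCM L e₁ dV hdV hdV0 (toHeckeCharacter L μ) ((isOscillatorChar_toHeckeCharacter_iff μ).mpr hμ) ε).omegaLoc v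
                  (((localLineInl L (IsCMField.complexConj L) 3 e₁ (Matrix.diagonal dV) (JW (↥(maximalRealSubfield L)) L ε) v).comp
                    ((localPiEquiv L (IsCMField.complexConj L) 3 (Matrix.diagonal dV) v).symm.toMonoidHom.comp
                      (cmDatumLocalCongr L v T ha h).toMonoidHom)) (t : ↥(unitaryGroupOfForm (conjLocal L (IsCMField.complexConj L) v) (cmLocalForm L 3 v)))) f) =
                lineWeilCM L e₀ (kernelLineCM dV) (complexConj_kernelLineCM dV hdV) (kernelLineCM_ne_zero dV hdV0) μ hμ ε v u (π f)) :
    ∀ (L : Type) [Field L] [NumberField L] [IsCMField L]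
      {n' : ℕ} (e₁ : Fin 3 × Fin 1 ≃ Fin n') (dV : Fin 3 → L) (hdV : ∀ i, IsCMField.complexConj L (dV i) = dV i) (hdV0 : ∀ i, dV i ≠ 0)
      {n₀ : ℕ} (e₀ : Fin 1 × Fin 1 ≃ Fin n₀)
      (μ : Literature.NumberTheory.Automorphic.IdeleClassGroup L →ₜ* Circle) (hμ : IsConjugateSymplectic L μ)
      (χf : UnitaryGroup.finAdelicOne (↥(maximalRealSubfield L)) L (IsCMField.complexConj L) →* ℂˣ),
      Continuous χf → (∀ z, ‖((χf z : ℂˣ) : ℂ)‖ = 1) →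
      ∀ (v : HeightOneSpectrum (𝓞 ↥(maximalRealSubfield L))),
        (∀ w : PlacesOver L v, IsCMField.complexConj L • w.1 = w.1) →
        ∀ (ε : (↥(maximalRealSubfield L))ˣ) (ψθ : ↥(normOneUnits (conjLocal L (IsCMField.complexConj L) v)) →* ℂˣ),
          IsThetaCenterChar L μ χf ε v ψθ →
          ∀ (T : GL (Fin 3) (UnitaryGroup.LocalRing L v)) (a : UnitaryGroup.LocalRing L v) (ha : IsUnit a)
            (h : formCongr (conjLocal L (IsCMField.complexConj L) v) T ((Matrix.diagonal dV).map (algebraMap L (UnitaryGroup.LocalRing L v))) =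
              a • (Matrix.of fun i j : Fin 3 => if i.val + j.val + 1 = 3 then (1 : L) else 0).map (algebraMap L (UnitaryGroup.LocalRing L v))),
            Nonempty (((cmBorelTriple L 3 v).restrict (xThetaGqsCM L e₁ dV hdV hdV0 μ hμ χf ε v T ha h)).Coinvariants ≃ₗ[ℂ]
              ↥(weightSpace (lineWeilCM L e₀ (kernelLineCM dV) (complexConj_kernelLineCM dV hdV) (kernelLineCM_ne_zero dV hdV0) μ hμ ε v) id
                (fun u => ((ψθ (localDet (IsCMField.complexConj L) v
                  (isUnit_iff_ne_zero.mpr (by rw [Matrix.det_fin_one]; exact JW_apply_ne_zero (↥(maximalRealSubfield L)) L ε))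
                  (localPiEquiv L (IsCMField.complexConj L) 1 (JW (↥(maximalRealSubfield L)) L ε) v u)) : ℂˣ) : ℂ)))) := by
  intro L _ _ _ n' e₁ dV hdV hdV0 n₀ e₀ μ hμ χf hc _ v hv ε ψθ hθ T a ha h
  obtain ⟨π, hπ, hker, hline⟩ := hL L e₁ dV hdV hdV0 e₀ μ hμ v hv ε T a ha h
  exact nonempty_jacquet_xThetaGqsCM_equiv_weightSpace_of_chartLine L e₁ dV hdV hdV0 e₀ μ hμ χf ε v hv hc ψθ hθ T ha h π hπ hker
    (LinearEquiv.refl ℂ _) hline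

end Summit.HodgeConjecture.HodgeConjecture.Cruxes.H413.F0P2oN3OfLineJacquetChart

end
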